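import Mathlib
import Summits.NavierStokesRegularity.NavierStokesRegularity.Theorems.HeteroclinicTriggerChainTriggerChainFrontStepLatticeCapture
import HarnessLib

/-!
# `HeteroclinicTriggerChain` — crux `TriggerChainFrontStep` (item stmt-NavierStokesRegularity-22785):
  the forced arc AT AN ARBITRARY SHELL of an exact lattice flow (gains `2^{5n/2}`)

`…LatticeCapture` / `…LatticeDelay` identify the front block at the shells `0, 1`. The same structure
holds at every shell `n` with the clock `2^{5n/2}·e` — needed for the WAKE (shell `−1` in current units:
the old trigger decays while the new carrier exceeds the leftover, `D_{−1} = S_{i₀,−1} − S_{i₀,0} < 0`,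
via `heteroclinicTriggerChain_forcedArcOn_trigger_decay`) and for the hop before rescaling. For an exact
flow `S` of `α₀ + βσ` on `[0,T]` (`α₀` in normal form at `i₀`, parity at `i₁`, `g = e = d i₁ 0 > 0`,
`|α₀| ≤ 1`), with `D_n = S_{i₀,n} − S_{i₀,n+1}`, `u_n = S_{i₁,n}` and the gains
`γ₀ = 2^{5n/2}`, `γ₋ = 2^{5(n−1)/2}`, `γ₊ = 2^{5(n+1)/2}`:

  `D_n′ = −2γ₀e·u_n² + f₁`,  `u_n′ = γ₀e·D_n·u_n + f₂`,
  `|f₁| ≤ γ₀·6ι² + γ₋·(2ω² + 2ι²) + γ₊·(2V² + 4ι²) + 2βB_σ`,  `|f₂| ≤ γ₀·(8Mι + 4Vι) + γ₋·4ωι + βB_σ`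

(`htcLB_front_block_shell`), from envelopes at shells `n−1, n, n+1`: junk `ι`, upper trigger
`V ≥ |S_{i₁,n+1}|`, wake trigger `ω ≥ |S_{i₁,n−1}|`, the three `σ`-rows `B_σ`, front block `M`.

HONEST FRAMING: a statement about exact flows of Tao-type MODEL lattices (Tao 2016 §4) under envelope
hypotheses supplied elsewhere; helper for the crux (no stub credit); nothing here is a statement about
the Navier–Stokes equations; no summit, rung or crux is proved.
-/

noncomputable section

set_option linter.dupNamespace false

open Real Set

namespace Summit.NavierStokesRegularity.NavierStokesRegularity.Theorems

open Literature.Analysis.FluidPDE Literature.Analysis.FluidPDE.TaoCascade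

/-- Bookkeeping inequality for the carrier-side remainder with symbolic gains. [folklore] -/
theorem htcLB_f1_abs_le {e γ₀ γ₁ γ₂ R₁ R₂ R₃ R₄ w v Δ ι ω V β Bσ : ℝ} (he0 : 0 ≤ e) (he2 : e ≤ 2)
    (hγ₀ : 0 ≤ γ₀) (hγ₁ : 0 ≤ γ₁) (hγ₂ : 0 ≤ γ₂)
    (hR₁ : |R₁| ≤ 4 * ι ^ 2) (hR₂ : |R₂| ≤ 2 * ι ^ 2) (hR₃ : |R₃| ≤ 4 * ι ^ 2) (hR₄ : |R₄| ≤ 2 * ι ^ 2)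
    (hw : |w| ≤ ω) (hv : |v| ≤ V) (hΔ : |Δ| ≤ 2 * Bσ) (hβ : 0 ≤ β) :
    |-(γ₀ * R₁) + γ₁ * (e * w ^ 2 + R₂) + γ₂ * (e * v ^ 2 + R₃) - γ₀ * R₄ + β * Δ| ≤
      γ₀ * (6 * ι ^ 2) + γ₁ * (2 * ω ^ 2 + 2 * ι ^ 2) + γ₂ * (2 * V ^ 2 + 4 * ι ^ 2) + 2 * β * Bσ := by
  have hw2 : w ^ 2 ≤ ω ^ 2 := by
    have := abs_nonneg w; nlinarith [sq_abs w, abs_nonneg w]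
  have hv2 : v ^ 2 ≤ V ^ 2 := by
    have := abs_nonneg v; nlinarith [sq_abs v, abs_nonneg v]
  have h1 : |γ₀ * R₁| ≤ γ₀ * (4 * ι ^ 2) := by
    rw [abs_mul, abs_of_nonneg hγ₀]; exact mul_le_mul_of_nonneg_left hR₁ hγ₀
  have h4 : |γ₀ * R₄| ≤ γ₀ * (2 * ι ^ 2) := by
    rw [abs_mul, abs_of_nonneg hγ₀]; exact mul_le_mul_of_nonneg_left hR₄ hγ₀
  have h2 : |γ₁ * (e * w ^ 2 + R₂)| ≤ γ₁ * (2 * ω ^ 2 + 2 * ι ^ 2) := by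
    rw [abs_mul, abs_of_nonneg hγ₁]
    refine mul_le_mul_of_nonneg_left ?_ hγ₁
    calc |e * w ^ 2 + R₂| ≤ |e * w ^ 2| + |R₂| := abs_add_le _ _
      _ ≤ 2 * ω ^ 2 + 2 * ι ^ 2 := by
          rw [abs_of_nonneg (by positivity)]; nlinarith
  have h3 : |γ₂ * (e * v ^ 2 + R₃)| ≤ γ₂ * (2 * V ^ 2 + 4 * ι ^ 2) := by
    rw [abs_mul, abs_of_nonneg hγ₂]
    refine mul_le_mul_of_nonneg_left ?_ hγ₂
    calc |e * v ^ 2 + R₃| ≤ |e * v ^ 2| + |R₃| := abs_add_le _ _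
      _ ≤ 2 * V ^ 2 + 4 * ι ^ 2 := by
          rw [abs_of_nonneg (by positivity)]; nlinarith
  have h5 : |β * Δ| ≤ 2 * β * Bσ := by
    rw [abs_mul, abs_of_nonneg hβ]; nlinarith
  calc |-(γ₀ * R₁) + γ₁ * (e * w ^ 2 + R₂) + γ₂ * (e * v ^ 2 + R₃) - γ₀ * R₄ + β * Δ|
      ≤ |-(γ₀ * R₁) + γ₁ * (e * w ^ 2 + R₂) + γ₂ * (e * v ^ 2 + R₃) - γ₀ * R₄| + |β * Δ| :=
        abs_add_le _ _
    _ ≤ |-(γ₀ * R₁) + γ₁ * (e * w ^ 2 + R₂) + γ₂ * (e * v ^ 2 + R₃)| + |γ₀ * R₄| + |β * Δ| := by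
        linarith [abs_sub (-(γ₀ * R₁) + γ₁ * (e * w ^ 2 + R₂) + γ₂ * (e * v ^ 2 + R₃)) (γ₀ * R₄)]
    _ ≤ |-(γ₀ * R₁) + γ₁ * (e * w ^ 2 + R₂)| + |γ₂ * (e * v ^ 2 + R₃)| + |γ₀ * R₄| + |β * Δ| := by
        linarith [abs_add_le (-(γ₀ * R₁) + γ₁ * (e * w ^ 2 + R₂)) (γ₂ * (e * v ^ 2 + R₃))]
    _ ≤ |-(γ₀ * R₁)| + |γ₁ * (e * w ^ 2 + R₂)| + |γ₂ * (e * v ^ 2 + R₃)| + |γ₀ * R₄| + |β * Δ| := by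
        linarith [abs_add_le (-(γ₀ * R₁)) (γ₁ * (e * w ^ 2 + R₂))]
    _ ≤ γ₀ * (4 * ι ^ 2) + γ₁ * (2 * ω ^ 2 + 2 * ι ^ 2) + γ₂ * (2 * V ^ 2 + 4 * ι ^ 2) +
          γ₀ * (2 * ι ^ 2) + 2 * β * Bσ := by rw [abs_neg]; linarith
    _ = _ := by ring

/-- Bookkeeping inequality for the trigger-side remainder with symbolic gains. [folklore] -/
theorem htcLB_f2_abs_le {γ₀ γ₁ R₅ R₆ R₇ R₈ u v w q ι ω V M β Bσ : ℝ}
    (hγ₀ : 0 ≤ γ₀) (hγ₁ : 0 ≤ γ₁)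
    (hR₅ : |R₅| ≤ 2 * ι) (hR₆ : |R₆| ≤ 2 * ι) (hR₇ : |R₇| ≤ 2 * ι) (hR₈ : |R₈| ≤ 2 * ι)
    (hu : |u| ≤ M) (hv : |v| ≤ V) (hw : |w| ≤ ω) (hq : |q| ≤ Bσ) (hβ : 0 ≤ β) :
    |γ₀ * (2 * u * R₅ + 2 * v * R₆ + 2 * u * R₇) + γ₁ * (2 * w * R₈) + β * q| ≤
      γ₀ * (8 * M * ι + 4 * V * ι) + γ₁ * (4 * ω * ι) + β * Bσ := by
  have hA : |2 * u * R₅ + 2 * v * R₆ + 2 * u * R₇| ≤ 8 * M * ι + 4 * V * ι := by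
    have h1 : |2 * u * R₅| ≤ 2 * M * (2 * ι) := by
      rw [abs_mul, abs_mul, abs_two]
      exact mul_le_mul (by linarith) hR₅ (abs_nonneg _) (by linarith [abs_nonneg u])
    have h2 : |2 * v * R₆| ≤ 2 * V * (2 * ι) := by
      rw [abs_mul, abs_mul, abs_two]
      exact mul_le_mul (by linarith) hR₆ (abs_nonneg _) (by linarith [abs_nonneg v])
    have h3 : |2 * u * R₇| ≤ 2 * M * (2 * ι) := by
      rw [abs_mul, abs_mul, abs_two]
      exact mul_le_mul (by linarith) hR₇ (abs_nonneg _) (by linarith [abs_nonneg u])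
    calc |2 * u * R₅ + 2 * v * R₆ + 2 * u * R₇| ≤ |2 * u * R₅ + 2 * v * R₆| + |2 * u * R₇| :=
          abs_add_le _ _
      _ ≤ |2 * u * R₅| + |2 * v * R₆| + |2 * u * R₇| := by
          linarith [abs_add_le (2 * u * R₅) (2 * v * R₆)]
      _ ≤ _ := by linarith
  have hB : |2 * w * R₈| ≤ 4 * ω * ι := by
    rw [abs_mul, abs_mul, abs_two]
    have := mul_le_mul hw hR₈ (abs_nonneg _) ((abs_nonneg _).trans hw)
    nlinarith [abs_nonneg w, abs_nonneg R₈]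
  have h1 : |γ₀ * (2 * u * R₅ + 2 * v * R₆ + 2 * u * R₇)| ≤ γ₀ * (8 * M * ι + 4 * V * ι) := by
    rw [abs_mul, abs_of_nonneg hγ₀]; exact mul_le_mul_of_nonneg_left hA hγ₀
  have h2 : |γ₁ * (2 * w * R₈)| ≤ γ₁ * (4 * ω * ι) := by
    rw [abs_mul, abs_of_nonneg hγ₁]; exact mul_le_mul_of_nonneg_left hB hγ₁
  have h3 : |β * q| ≤ β * Bσ := by
    rw [abs_mul, abs_of_nonneg hβ]; exact mul_le_mul_of_nonneg_left hq hβ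
  calc |γ₀ * (2 * u * R₅ + 2 * v * R₆ + 2 * u * R₇) + γ₁ * (2 * w * R₈) + β * q|
      ≤ |γ₀ * (2 * u * R₅ + 2 * v * R₆ + 2 * u * R₇) + γ₁ * (2 * w * R₈)| + |β * q| := abs_add_le _ _
    _ ≤ |γ₀ * (2 * u * R₅ + 2 * v * R₆ + 2 * u * R₇)| + |γ₁ * (2 * w * R₈)| + |β * q| := by
        linarith [abs_add_le (γ₀ * (2 * u * R₅ + 2 * v * R₆ + 2 * u * R₇)) (γ₁ * (2 * w * R₈))]
    _ ≤ _ := by linarith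

/-- **THE FORCED ARC AT SHELL `n` OF AN EXACT LATTICE FLOW.** Setting of the module docstring; the
gains are written `(1+1)^{5n/2}`, `(1+1)^{5(n−1)/2}`, `(1+1)^{5(n+1)/2}`. [this file] -/
theorem htcLB_front_block_shell (α₀ σ : Fin 4 → Fin 4 → Fin 4 → ℤ × ℤ × ℤ → ℝ) (i₀ i₁ : Fin 4)
    (d : Fin 4 → ℤ → ℝ) (hne : i₀ ≠ i₁)
    (hsym : IsSymmetricCoeff α₀) (hcanc : IsCancellingCoeff α₀)
    (hpure : ∀ X : Fin 4 → ℤ → ℝ → ℝ, (∀ i n t, i ≠ i₀ → X i n t = 0) →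
      ∀ i n t, quadTerm 1 α₀ X i n t = 0)
    (hsad : ∀ (Y : Fin 4 → ℤ → ℝ → ℝ) (i : Fin 4) (n : ℤ) (t : ℝ),
      quadTerm 1 α₀ (fun j m s => (fun j m (_ : ℝ) => if j = i₀ ∧ m = 0 then (1 : ℝ) else 0) j m s +
          Y j m s) i n t -
        quadTerm 1 α₀ (fun j m (_ : ℝ) => if j = i₀ ∧ m = 0 then (1 : ℝ) else 0) i n t -
        quadTerm 1 α₀ Y i n t = d i n * Y i n t)
    (hpar : ∀ (j₁ j₂ j₃ : Fin 4) (μ : ℤ × ℤ × ℤ),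
      Xor (Xor (j₁ = i₁) (j₂ = i₁)) (j₃ = i₁) → α₀ j₁ j₂ j₃ μ = 0)
    (hα1 : ∀ a b c μ, |α₀ a b c μ| ≤ 1)
    (hg : α₀ i₁ i₁ i₀ (0, 0, 1) = d i₁ 0) (he : 0 < d i₁ 0)
    (β : ℝ) (hβ : 0 ≤ β) (S : Fin 4 → ℤ → ℝ → ℝ) {T : ℝ} (n : ℤ)
    (hS : ∀ i k, ∀ t ∈ Icc 0 T, HasDerivWithinAt (S i k)
      (quadTerm 1 α₀ S i k t + β * quadTerm 1 σ S i k t) (Icc 0 T) t)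
    {M V ι ω Bσ : ℝ} (hι0 : 0 ≤ ι)
    (hM : ∀ t ∈ Icc 0 T, |S i₀ n t - S i₀ (n + 1) t| ≤ M ∧ |S i₁ n t| ≤ M)
    (hV : ∀ t ∈ Icc 0 T, |S i₁ (n + 1) t| ≤ V) (hω : ∀ t ∈ Icc 0 T, |S i₁ (n - 1) t| ≤ ω)
    (hι : ∀ t ∈ Icc 0 T, ∀ a, a ≠ i₀ → a ≠ i₁ →
      |S a n t| ≤ ι ∧ |S a (n + 1) t| ≤ ι ∧ |S a (n - 1) t| ≤ ι)
    (hBσ : ∀ t ∈ Icc 0 T, |quadTerm 1 σ S i₀ n t| ≤ Bσ ∧ |quadTerm 1 σ S i₀ (n + 1) t| ≤ Bσ ∧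
      |quadTerm 1 σ S i₁ n t| ≤ Bσ) :
    ∃ f₁ f₂ : ℝ → ℝ,
      (∀ t ∈ Icc 0 T, HasDerivWithinAt (fun t => S i₀ n t - S i₀ (n + 1) t)
        (-(2 * (1 + 1 : ℝ) ^ ((5 : ℝ) * n / 2) * d i₁ 0 * S i₁ n t ^ 2) + f₁ t) (Icc 0 T) t) ∧
      (∀ t ∈ Icc 0 T, HasDerivWithinAt (S i₁ n)
        ((1 + 1 : ℝ) ^ ((5 : ℝ) * n / 2) * d i₁ 0 * (S i₀ n t - S i₀ (n + 1) t) * S i₁ n t + f₂ t)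
        (Icc 0 T) t) ∧
      (∀ t ∈ Icc 0 T, |f₁ t| ≤
        (1 + 1 : ℝ) ^ ((5 : ℝ) * n / 2) * (6 * ι ^ 2) +
          (1 + 1 : ℝ) ^ ((5 : ℝ) * ((n : ℝ) - 1) / 2) * (2 * ω ^ 2 + 2 * ι ^ 2) +
          (1 + 1 : ℝ) ^ ((5 : ℝ) * ((n : ℝ) + 1) / 2) * (2 * V ^ 2 + 4 * ι ^ 2) + 2 * β * Bσ) ∧
      (∀ t ∈ Icc 0 T, |f₂ t| ≤
        (1 + 1 : ℝ) ^ ((5 : ℝ) * n / 2) * (8 * M * ι + 4 * V * ι) +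
          (1 + 1 : ℝ) ^ ((5 : ℝ) * ((n : ℝ) - 1) / 2) * (4 * ω * ι) + β * Bσ) := by
  -- normal-form facts
  obtain ⟨nf1, -, -, nf4, -, -, nf7, -, -⟩ :=
    HeteroclinicTriggerChain.stub_normal_form α₀ i₀ d hsym hcanc hpure hsad
  obtain ⟨hc0, hc1, hc2, hc3⟩ := htcTR_trigger_carrier_coefficients α₀ i₀ i₁ d hsym hcanc hpure hsad
  have m001 : ((0 : ℤ), (0 : ℤ), (1 : ℤ)) ∈ shiftSet := by decide
  have hg0 : α₀ i₀ i₀ i₀ (0, 0, 1) = 0 := nf1 i₀ (0, 0, 1) m001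
  have hd0 : d i₀ 0 = 0 := nf7 0
  have hpar3 : ∀ μ : ℤ × ℤ × ℤ, α₀ i₁ i₁ i₁ μ = 0 := fun μ => hpar i₁ i₁ i₁ μ (by simp [Xor])
  have he2 : d i₁ 0 ≤ 2 := by
    rw [nf4 i₁]; have := (abs_le.1 (hα1 i₀ i₁ i₁ (0, 0, 0))).2; linarith
  have hda : ∀ a, |d a 0| ≤ 2 := fun a => by
    rw [nf4 a, abs_mul, abs_two]; linarith [hα1 i₀ a a (0, 0, 0)]
  -- the gains
  set γ₀ : ℝ := (1 + 1 : ℝ) ^ ((5 : ℝ) * n / 2) with hγ₀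
  set γ₁ : ℝ := (1 + 1 : ℝ) ^ ((5 : ℝ) * ((n : ℝ) - 1) / 2) with hγ₁
  set γ₂ : ℝ := (1 + 1 : ℝ) ^ ((5 : ℝ) * ((n : ℝ) + 1) / 2) with hγ₂
  have hγ₀0 : 0 ≤ γ₀ := Real.rpow_nonneg (by norm_num) _
  have hγ₁0 : 0 ≤ γ₁ := Real.rpow_nonneg (by norm_num) _
  have hγ₂0 : 0 ≤ γ₂ := Real.rpow_nonneg (by norm_num) _
  -- pointwise junk bounds
  have hsq : ∀ {z : ℝ}, |z| ≤ ι → z ^ 2 ≤ ι ^ 2 := fun {z} hz => by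
    have := abs_nonneg z; nlinarith [sq_abs z]
  have hjd : ∀ (a : Fin 4) (z : ℝ), |z| ≤ ι → |d a 0 * z ^ 2| ≤ 2 * ι ^ 2 := fun a z hz => by
    rw [abs_mul, abs_of_nonneg (sq_nonneg z)]
    exact mul_le_mul (hda a) (hsq hz) (sq_nonneg _) (by norm_num)
  have hjg : ∀ (a : Fin 4) (z : ℝ), |z| ≤ ι → |α₀ a a i₀ (0, 0, 1) * z ^ 2| ≤ ι ^ 2 := fun a z hz => by
    rw [abs_mul, abs_of_nonneg (sq_nonneg z)]
    calc |α₀ a a i₀ (0, 0, 1)| * z ^ 2 ≤ 1 * ι ^ 2 :=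
        mul_le_mul (hα1 a a i₀ _) (hsq hz) (sq_nonneg _) (by norm_num)
      _ = ι ^ 2 := one_mul _
  have hjb : ∀ (c z : ℝ), |c| ≤ 1 → |z| ≤ ι → |c * z| ≤ ι := fun c z hc hz => by
    rw [abs_mul]
    calc |c| * |z| ≤ 1 * ι := mul_le_mul hc hz (abs_nonneg _) (by norm_num)
      _ = ι := one_mul _
  refine ⟨fun t => (quadTerm 1 α₀ S i₀ n t + β * quadTerm 1 σ S i₀ n t) -
      (quadTerm 1 α₀ S i₀ (n + 1) t + β * quadTerm 1 σ S i₀ (n + 1) t) + 2 * γ₀ * d i₁ 0 * S i₁ n t ^ 2,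
    fun t => (quadTerm 1 α₀ S i₁ n t + β * quadTerm 1 σ S i₁ n t) -
      γ₀ * d i₁ 0 * (S i₀ n t - S i₀ (n + 1) t) * S i₁ n t, ?_, ?_, ?_, ?_⟩
  · intro t ht
    exact ((hS i₀ n t ht).sub (hS i₀ (n + 1) t ht)).congr_deriv (by ring)
  · intro t ht
    exact (hS i₁ n t ht).congr_deriv (by ring)
  · -- carrier side
    intro t ht
    have hx := htcCR_quadTerm_carrier α₀ i₀ d hsym hcanc hpure hsad S n t
    have hy := htcCR_quadTerm_carrier α₀ i₀ d hsym hcanc hpure hsad S (n + 1) t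
    have c1 : (1 + 1 : ℝ) ^ ((5 : ℝ) * ((n + 1 : ℤ) : ℝ) / 2) = γ₂ := by
      rw [hγ₂]; push_cast; ring_nf
    have c2 : (1 + 1 : ℝ) ^ ((5 : ℝ) * ((((n + 1 : ℤ)) : ℝ) - 1) / 2) = γ₀ := by
      rw [hγ₀]; push_cast; ring_nf
    have c3 : (n + 1 - 1 : ℤ) = n := by ring
    rw [c1, c2, c3] at hy
    have hjunk0 : ∀ a, a ≠ i₀ → a ≠ i₁ → |S a n t| ≤ ι := fun a h0 h1 => (hι t ht a h0 h1).1
    have hjunk1 : ∀ a, a ≠ i₀ → a ≠ i₁ → |S a (n + 1) t| ≤ ι := fun a h0 h1 => (hι t ht a h0 h1).2.1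
    have hjunkm : ∀ a, a ≠ i₀ → a ≠ i₁ → |S a (n - 1) t| ≤ ι := fun a h0 h1 => (hι t ht a h0 h1).2.2
    set R₁ : ℝ := ∑ a, d a 0 * S a n t ^ 2 - d i₁ 0 * S i₁ n t ^ 2 with hR₁
    set R₂ : ℝ := ∑ a, α₀ a a i₀ (0, 0, 1) * S a (n - 1) t ^ 2 - d i₁ 0 * S i₁ (n - 1) t ^ 2 with hR₂
    set R₃ : ℝ := ∑ a, d a 0 * S a (n + 1) t ^ 2 - d i₁ 0 * S i₁ (n + 1) t ^ 2 with hR₃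
    set R₄ : ℝ := ∑ a, α₀ a a i₀ (0, 0, 1) * S a n t ^ 2 - d i₁ 0 * S i₁ n t ^ 2 with hR₄
    have hB₁ : |R₁| ≤ 4 * ι ^ 2 := by
      have h := htcLC_sum_split (fun a => d a 0 * S a n t ^ 2) hne (B := 2 * ι ^ 2)
        (fun a h0 h1 => hjd a _ (hjunk0 a h0 h1))
      have key : R₁ = ∑ a, d a 0 * S a n t ^ 2 - d i₀ 0 * S i₀ n t ^ 2 - d i₁ 0 * S i₁ n t ^ 2 := by
        rw [hR₁, hd0]; ring
      rw [key]; linarith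
    have hB₂ : |R₂| ≤ 2 * ι ^ 2 := by
      have h := htcLC_sum_split (fun a => α₀ a a i₀ (0, 0, 1) * S a (n - 1) t ^ 2) hne (B := ι ^ 2)
        (fun a h0 h1 => hjg a _ (hjunkm a h0 h1))
      have key : R₂ = ∑ a, α₀ a a i₀ (0, 0, 1) * S a (n - 1) t ^ 2 -
          α₀ i₀ i₀ i₀ (0, 0, 1) * S i₀ (n - 1) t ^ 2 - α₀ i₁ i₁ i₀ (0, 0, 1) * S i₁ (n - 1) t ^ 2 := by
        rw [hR₂, hg0, hg]; ring
      rw [key]; linarith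
    have hB₃ : |R₃| ≤ 4 * ι ^ 2 := by
      have h := htcLC_sum_split (fun a => d a 0 * S a (n + 1) t ^ 2) hne (B := 2 * ι ^ 2)
        (fun a h0 h1 => hjd a _ (hjunk1 a h0 h1))
      have key : R₃ = ∑ a, d a 0 * S a (n + 1) t ^ 2 - d i₀ 0 * S i₀ (n + 1) t ^ 2 -
          d i₁ 0 * S i₁ (n + 1) t ^ 2 := by
        rw [hR₃, hd0]; ring
      rw [key]; linarith
    have hB₄ : |R₄| ≤ 2 * ι ^ 2 := by
      have h := htcLC_sum_split (fun a => α₀ a a i₀ (0, 0, 1) * S a n t ^ 2) hne (B := ι ^ 2)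
        (fun a h0 h1 => hjg a _ (hjunk0 a h0 h1))
      have key : R₄ = ∑ a, α₀ a a i₀ (0, 0, 1) * S a n t ^ 2 -
          α₀ i₀ i₀ i₀ (0, 0, 1) * S i₀ n t ^ 2 - α₀ i₁ i₁ i₀ (0, 0, 1) * S i₁ n t ^ 2 := by
        rw [hR₄, hg0, hg]; ring
      rw [key]; linarith
    have hΔ : |quadTerm 1 σ S i₀ n t - quadTerm 1 σ S i₀ (n + 1) t| ≤ 2 * Bσ := by
      calc |quadTerm 1 σ S i₀ n t - quadTerm 1 σ S i₀ (n + 1) t|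
          ≤ |quadTerm 1 σ S i₀ n t| + |quadTerm 1 σ S i₀ (n + 1) t| := abs_sub _ _
        _ ≤ 2 * Bσ := by linarith [(hBσ t ht).1, (hBσ t ht).2.1]
    have heq : (quadTerm 1 α₀ S i₀ n t + β * quadTerm 1 σ S i₀ n t) -
        (quadTerm 1 α₀ S i₀ (n + 1) t + β * quadTerm 1 σ S i₀ (n + 1) t) +
          2 * γ₀ * d i₁ 0 * S i₁ n t ^ 2 =
        -(γ₀ * R₁) + γ₁ * (d i₁ 0 * S i₁ (n - 1) t ^ 2 + R₂) +
          γ₂ * (d i₁ 0 * S i₁ (n + 1) t ^ 2 + R₃) - γ₀ * R₄ +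
          β * (quadTerm 1 σ S i₀ n t - quadTerm 1 σ S i₀ (n + 1) t) := by
      rw [hx, hy, hR₁, hR₂, hR₃, hR₄]; ring
    show |(quadTerm 1 α₀ S i₀ n t + β * quadTerm 1 σ S i₀ n t) -
        (quadTerm 1 α₀ S i₀ (n + 1) t + β * quadTerm 1 σ S i₀ (n + 1) t) +
          2 * γ₀ * d i₁ 0 * S i₁ n t ^ 2| ≤ _
    rw [heq]
    exact htcLB_f1_abs_le he.le he2 hγ₀0 hγ₁0 hγ₂0 hB₁ hB₂ hB₃ hB₄ (hω t ht) (hV t ht) hΔ hβ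
  · -- trigger side
    intro t ht
    have hu := htcTR_quadTerm_trigger α₀ i₁ hsym hpar S n t
    have hjunk0 : ∀ a, a ≠ i₀ → a ≠ i₁ → |S a n t| ≤ ι := fun a h0 h1 => (hι t ht a h0 h1).1
    have hjunk1 : ∀ a, a ≠ i₀ → a ≠ i₁ → |S a (n + 1) t| ≤ ι := fun a h0 h1 => (hι t ht a h0 h1).2.1
    have hjunkm : ∀ a, a ≠ i₀ → a ≠ i₁ → |S a (n - 1) t| ≤ ι := fun a h0 h1 => (hι t ht a h0 h1).2.2
    set R₅ : ℝ := ∑ b, α₀ i₁ b i₁ (0, 0, 0) * S b n t - d i₁ 0 / 2 * S i₀ n t with hR₅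
    set R₆ : ℝ := ∑ b, α₀ i₁ b i₁ (1, 0, 0) * S b n t with hR₆
    set R₇ : ℝ := ∑ b, α₀ b i₁ i₁ (1, 0, 0) * S b (n + 1) t + d i₁ 0 / 2 * S i₀ (n + 1) t with hR₇
    set R₈ : ℝ := ∑ b, α₀ i₁ b i₁ (0, 0, 1) * S b (n - 1) t with hR₈
    have hB₅ : |R₅| ≤ 2 * ι := by
      have h := htcLC_sum_split (fun b => α₀ i₁ b i₁ (0, 0, 0) * S b n t) hne (B := ι)
        (fun a h0 h1 => hjb _ _ (hα1 _ _ _ _) (hjunk0 a h0 h1))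
      have key : R₅ = ∑ b, α₀ i₁ b i₁ (0, 0, 0) * S b n t - α₀ i₁ i₀ i₁ (0, 0, 0) * S i₀ n t -
          α₀ i₁ i₁ i₁ (0, 0, 0) * S i₁ n t := by
        rw [hR₅, hc0, hpar3]; ring
      rw [key]; exact h
    have hB₆ : |R₆| ≤ 2 * ι := by
      have h := htcLC_sum_split (fun b => α₀ i₁ b i₁ (1, 0, 0) * S b n t) hne (B := ι)
        (fun a h0 h1 => hjb _ _ (hα1 _ _ _ _) (hjunk0 a h0 h1))
      have key : R₆ = ∑ b, α₀ i₁ b i₁ (1, 0, 0) * S b n t - α₀ i₁ i₀ i₁ (1, 0, 0) * S i₀ n t -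
          α₀ i₁ i₁ i₁ (1, 0, 0) * S i₁ n t := by
        rw [hR₆, hc1, hpar3]; ring
      rw [key]; exact h
    have hB₇ : |R₇| ≤ 2 * ι := by
      have h := htcLC_sum_split (fun b => α₀ b i₁ i₁ (1, 0, 0) * S b (n + 1) t) hne (B := ι)
        (fun a h0 h1 => hjb _ _ (hα1 _ _ _ _) (hjunk1 a h0 h1))
      have key : R₇ = ∑ b, α₀ b i₁ i₁ (1, 0, 0) * S b (n + 1) t -
          α₀ i₀ i₁ i₁ (1, 0, 0) * S i₀ (n + 1) t - α₀ i₁ i₁ i₁ (1, 0, 0) * S i₁ (n + 1) t := by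
        rw [hR₇, hc2, hg, hpar3]; ring
      rw [key]; exact h
    have hB₈ : |R₈| ≤ 2 * ι := by
      have h := htcLC_sum_split (fun b => α₀ i₁ b i₁ (0, 0, 1) * S b (n - 1) t) hne (B := ι)
        (fun a h0 h1 => hjb _ _ (hα1 _ _ _ _) (hjunkm a h0 h1))
      have key : R₈ = ∑ b, α₀ i₁ b i₁ (0, 0, 1) * S b (n - 1) t -
          α₀ i₁ i₀ i₁ (0, 0, 1) * S i₀ (n - 1) t - α₀ i₁ i₁ i₁ (0, 0, 1) * S i₁ (n - 1) t := by
        rw [hR₈, hc3, hpar3]; ring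
      rw [key]; exact h
    have heq : (quadTerm 1 α₀ S i₁ n t + β * quadTerm 1 σ S i₁ n t) -
        γ₀ * d i₁ 0 * (S i₀ n t - S i₀ (n + 1) t) * S i₁ n t =
        γ₀ * (2 * S i₁ n t * R₅ + 2 * S i₁ (n + 1) t * R₆ + 2 * S i₁ n t * R₇) +
          γ₁ * (2 * S i₁ (n - 1) t * R₈) + β * quadTerm 1 σ S i₁ n t := by
      rw [hu, hR₅, hR₆, hR₇, hR₈]; ring
    show |(quadTerm 1 α₀ S i₁ n t + β * quadTerm 1 σ S i₁ n t) -
        γ₀ * d i₁ 0 * (S i₀ n t - S i₀ (n + 1) t) * S i₁ n t| ≤ _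
    rw [heq]
    exact htcLB_f2_abs_le hγ₀0 hγ₁0 hB₅ hB₆ hB₇ hB₈ (hM t ht).2 (hV t ht) (hω t ht) (hBσ t ht).2.2 hβ

end Summit.NavierStokesRegularity.NavierStokesRegularity.Theorems

end
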